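import Literature.NumberTheory.Automorphic.NewformAdelisationHeckeOperator
import Literature.NumberTheory.Automorphic.AutomorphicRepsGL2WeightOneHeckeEigenform
import Literature.NumberTheory.Automorphic.AutomorphicRepOfForm
import Literature.NumberTheory.Automorphic.AutomorphicRepCuspidalPart
import Literature.NumberTheory.Automorphic.WeightOneDescent
import HarnessLib

/-!
# The cuspidal automorphic representation generated by the adelic lift of an eigenform, and its
# Satake parameters away from the level (Gelbart 1975, §3; Gelbart 1997, Prop. 2.5, weight `k`)

Topic `NumberTheory/Automorphic`; theorems only (no definition, no named fact; D-0026). Brick of the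
dictionary `f ↦ π_f`: for a cusp form `f ∈ S_k(N, χ)`, `f ≠ 0`, with `T_p f = a_p f` for the primes
`p ∤ N`, the adelic lift `φ_f` is a non-zero `K(N)`-fixed cusp form on `GL₂(𝔸_ℚ)`
(`adelicLiftFunA_mem_cuspFormsGL`), so it generates a cuspidal automorphic representation
`P = W / W'` with `φ_f ∈ W ∖ W'` (`IsStableSubmodule.exists_automorphicRepData_mem_not_mem` on any
stable space `V ≤ 𝒜₀` containing `φ_f`, e.g. `𝒜₀` itself, `isStableSubmodule_cuspFormsGL`), and at every place `v` over `p ∤ N` the Hecke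
eigenvalue equations `T_{p,1} φ_f = (√p)^{2-k} a_p φ_f`, `T_{p,2} φ_f = χ(p) φ_f`
(`heckeOperator_principalCongruenceLevel_adelicLiftFunA_one/two`) give `P` the Satake parameter
`α = {α₁, α₂}` with `α₁ + α₂ = a_p p^{(1-k)/2}`, `α₁ α₂ = χ(p)` — the unitary normalisation
(Gelbart 1997, (2.5.1): `p^{(k-1)/2}(μ₁(p) + μ₂(p)) = a_p`; Bump 1997, §3.6):

* `exists_cuspidalAutomorphicRepData_satake_of_eigenform`.

## References

* S. Gelbart, *Automorphic forms on adele groups* (1975), §3, Prop. 3.1, Lemma 3.7. [Gelbart1975]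
* S. Gelbart, *Three lectures …* (1997), Prop. 2.5 (b), (2.5.1). [Gelbart1997]
* D. Bump, *Automorphic Forms and Representations* (1997), §3.6. [Bump1997]
* A. Borel, H. Jacquet, Corvallis 1979, 4.4–4.6. [BorelJacquet1979]
-/

noncomputable section

open scoped MatrixGroups Classical
open NumberField IsDedekindDomain Polynomial

namespace Literature.NumberTheory.Automorphic

open EllipticCurves.ModularForms CongruenceSubgroup Rat.HeightOneSpectrum

variable {hcpt : isCompact_glFiniteIntegralLevel 2 ℚ} {N : ℕ} [NeZero N] {k : ℤ}

attribute [local instance] neZero_natGenerator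

omit [NeZero N] in
/-- `a • f = b • f` with `f ≠ 0` forces `a = b` (any weight). [folklore] -/
theorem CuspForm.smul_left_cancel_of_ne_zero' {f : CuspForm (Gamma1 N) k} (hf0 : f ≠ 0) {a b : ℂ}
    (h : a • f = b • f) : a = b := by
  by_contra hab
  have h' : (a - b) • f = 0 := by rw [sub_smul, h, sub_self]
  exact hf0 ((smul_eq_zero.mp h').resolve_left (sub_ne_zero.mpr hab))

/-- `φ_f ≠ 0` for `f ≠ 0` (`f ↦ φ_f` detects scalars, `CuspForm.eq_smul_of_adelicLiftFun_eq_smul`). [folklore] -/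
theorem adelicLiftFunA_ne_zero {f : CuspForm (Gamma1 N) k} (hf0 : f ≠ 0) : adelicLiftFunA N k f ≠ 0 := by
  intro h0
  apply hf0
  have h1 : adelicLiftFun N k ⇑f = (0 : ℂ) • adelicLiftFun N k ⇑f := by
    rw [zero_smul]; exact h0
  have := CuspForm.eq_smul_of_adelicLiftFun_eq_smul h1
  rwa [zero_smul] at this

/-- **The cuspidal automorphic representation of an eigenform and its Satake parameters.** Let
`f ∈ S_k(N, χ)`, `f ≠ 0`, with `T_p f = a_p f` for all primes `p ∤ N`, and let `V ≤ 𝒜₀` be a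
stable space of cusp forms containing `φ_f`. There is a cuspidal automorphic representation
`P = W / W'` of `GL₂(𝔸_ℚ)` (Borel–Jacquet 4.6) with `φ_f ∈ W ∖ W'`, `W ≤ V`,
such that for every finite place `v` of `ℚ` over a prime `p ∤ N`, `P` has at `v` a Satake
parameter `α` with `∏_{a ∈ α}(X - a) = X² - a_p p^{(1-k)/2} X + χ(p)`: the witness is the
`K(N)`-spherical vector `φ_f`, `T_{p,0} φ_f = φ_f`, `T_{p,1} φ_f = √p · (a_p p^{(1-k)/2}) φ_f`,
`T_{p,2} φ_f = χ(p) φ_f`. Gelbart 1997, Prop. 2.5 (b) and (2.5.1); Gelbart 1975, Lemma 3.7;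
Bump 1997, §3.6. [cite: Gelbart1997, Prop. 2.5 (b), (2.5.1)] [cite: Gelbart1975, Lemma 3.7]
[cite: BorelJacquet1979, 4.6] -/
theorem exists_cuspidalAutomorphicRepData_satake_of_eigenform
    {V : Submodule ℂ ((AdelicGroupData.gl 2 ℚ).Adelic → ℂ)} (hV : IsStableSubmodule (AutomorphyDatum.gl 2 ℚ hcpt) V)
    (hVc : V ≤ cuspFormsGL 2 ℚ hcpt)
    (f : CuspForm (Gamma1 N) k) (hf0 : f ≠ 0) (hφV : adelicLiftFunA N k f ∈ V)
    (χ : DirichletCharacter ℂ N) (hfχ : f ∈ nebentypusSubspace N k χ)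
    (a : ℕ → ℂ)
    (hT : ∀ (p : ℕ) (hp : p.Prime), ¬ p ∣ N →
      (haveI : NeZero p := ⟨hp.ne_zero⟩; EllipticCurves.ModularForms.heckeT (Gamma1 N) k p f) = a p • f) :
    ∃ P : CuspidalAutomorphicRepData 2 ℚ hcpt, adelicLiftFunA N k f ∈ P.1.W ∧ adelicLiftFunA N k f ∉ P.1.W' ∧
      P.1.W ≤ V ∧
      ∀ v : HeightOneSpectrum (𝓞 ℚ), ¬ ((primesEquiv v : Nat.Primes) : ℕ) ∣ N →
        ∃ α : Multiset ℂ, P.1.HasSatakeParamAt v α ∧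
          satakePolynomial α =
            X ^ 2 - C (a ((primesEquiv v : Nat.Primes) : ℕ) *
              (((Real.sqrt ((primesEquiv v : Nat.Primes) : ℕ) : ℝ) : ℂ) ^ (1 - k))) * X +
              C (χ ((((primesEquiv v : Nat.Primes) : ℕ) : ℕ) : ZMod N)) := by
  have h𝔫 : (Ideal.span {(N : 𝓞 ℚ)} : Ideal (𝓞 ℚ)) ≠ 0 := Rat.span_natCast_ne_zero N
  have hfixmem := adelicLiftFunA_mem_fixedPoints_principalCongruenceLevel (k := k) f
  have hfix : ∀ u ∈ principalCongruenceLevel 2 ℚ (Ideal.span {(N : 𝓞 ℚ)}),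
      rightTranslation (AdelicGroupData.gl 2 ℚ) u (adelicLiftFunA N k f) = adelicLiftFunA N k f := fun u hu =>
    ((rightTranslation (AdelicGroupData.gl 2 ℚ)).mem_fixedPoints _ (adelicLiftFunA N k f)).1 hfixmem u hu
  have hφ0 : adelicLiftFunA N k f ≠ 0 := adelicLiftFunA_ne_zero hf0
  obtain ⟨P, hφW, hφW', hle, hsat⟩ :=
    hV.exists_automorphicRepData_hasSatakeParamAt_of_eigenvector hφV hφ0 h𝔫 hfix
  refine ⟨⟨P, hle.trans hVc⟩, hφW, hφW', hle, fun v hvN => ?_⟩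
  have hp : ((primesEquiv (R := 𝓞 ℚ) v : Nat.Primes) : ℕ) = natGenerator v := rfl
  rw [hp] at hvN ⊢
  have hv : ¬ v.asIdeal ∣ Ideal.span {(N : 𝓞 ℚ)} := fun h => hvN ((Rat.natGenerator_dvd_iff v N).2 h)
  -- the eigenvalue equations on `φ_f`
  have hs0 : ((Real.sqrt (natGenerator v) : ℝ) : ℂ) ≠ 0 := by
    exact_mod_cast (Real.sqrt_pos.2 (Nat.cast_pos.2 (prime_natGenerator v).pos)).ne'
  obtain ⟨u, hu⟩ := ZMod.isUnit_prime_of_not_dvd (prime_natGenerator v) hvN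
  have hD : diamondOp N k ((natGenerator v : ℕ) : ZMod N) f = χ ((natGenerator v : ℕ) : ZMod N) • f := by
    rw [← hu]
    exact (mem_nebentypusSubspace_iff_diamondOp.mp hfχ) u
  have hTv : EllipticCurves.ModularForms.heckeT (Gamma1 N) k (natGenerator v) f = a (natGenerator v) • f := by
    have gen : ∀ (q : ℕ) (hq : q.Prime), ¬ q ∣ N → ∀ (hq' : NeZero q),
        (haveI := hq'; EllipticCurves.ModularForms.heckeT (Gamma1 N) k q f) = a q • f := by
      intro q hq hqN hq'
      have h := hT q hq hqN
      convert h
    exact gen (natGenerator v) (prime_natGenerator v) hvN inferInstance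
  have hsmul : ∀ c : ℂ, adelicLiftFunA N k ⇑(c • f) = c • adelicLiftFunA N k ⇑f := fun c => by
    have e : (⇑(c • f) : UpperHalfPlane → ℂ) = c • ⇑f := rfl
    rw [e]; exact adelicLiftFun_smul (N := N) (k := k) c ⇑f
  have L₁ := heckeOperator_principalCongruenceLevel_adelicLiftFunA_one (k := k) f hv
  have L₂ := heckeOperator_principalCongruenceLevel_adelicLiftFunA_two (k := k) f hv
  rw [hTv, hsmul, smul_smul] at L₁
  rw [hD, hsmul] at L₂
  -- the multiset with `e₀ = 1`, `e₁ = a_p (√p)^{1-k}`, `e₂ = χ(p)`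
  set e₁ : ℂ := a (natGenerator v) * ((Real.sqrt (natGenerator v) : ℝ) : ℂ) ^ (1 - k) with he₁
  set e₂ : ℂ := χ ((natGenerator v : ℕ) : ZMod N) with he₂
  obtain ⟨α, hcard, hα⟩ := exists_multiset_esymm_eq 2
    (fun i => if i = 0 then (1 : ℂ) else if i = 1 then e₁ else e₂) (if_pos rfl)
  have hα0 : α.esymm 0 = 1 := by rw [hα 0 (by norm_num)]; rfl
  have hα1 : α.esymm 1 = e₁ := by rw [hα 1 (by norm_num)]; rfl
  have hα2 : α.esymm 2 = e₂ := by rw [hα 2 le_rfl]; rfl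
  refine ⟨α, hsat v hv (Rat.localUniformizer v) α (Rat.valued_localUniformizer v) hcard fun i hi => ?_,
    by rw [AutomorphicRepData.satakePolynomial_eq_of_card_eq_two hcard hα0, hα1, hα2]⟩
  rw [GaloisRepresentations.Rat.residueCard_eq_natGenerator]
  interval_cases i
  · -- `T_{v,0} = 1`
    rw [heckeDiagAt_zero, hα0, Nat.zero_mul, pow_zero, one_mul, one_smul]
    exact heckeOperator_one_apply _ _ hfixmem
  · -- `T_{v,1} φ_f = (√p)^{2-k} a_p φ_f = √p e₁ φ_f`
    rw [hα1, L₁]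
    congr 1
    rw [he₁, show (1 : ℕ) * (2 - 1) = 1 by norm_num, pow_one, ← zpow_neg, neg_sub,
      show (2 - k : ℤ) = 1 + (1 - k) by ring, zpow_add₀ hs0, zpow_one]
    ring
  · -- `T_{v,2} φ_f = χ(p) φ_f = e₂ φ_f`
    rw [hα2, L₂]
    congr 1
    rw [he₂, show (2 : ℕ) * (2 - 2) = 0 by norm_num, pow_zero, one_mul]

end Literature.NumberTheory.Automorphic
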